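import Literature.Probability.LatticeModels.ChessboardEstimateOddTorus
import HarnessLib

/-!
# The TWISTED two-class chessboard estimate on a block torus of odd side — core bookkeeping

Support file for item stmt-QuantumFields-20194 (`DirichletWindow.AllSidesCouplingChessboard`, K1 of the large-field
sparsity line; seat ym-dw-p1 g3).  Part 1 of 2 (cylinders of blocks, gluing slices, the exponent count of the twisted
pair of symmetrisations, the functional `Φ` and its maximisers); the run-doubling walk and the estimate itself are in
`…AllSidesChessboardTwistedOdd`.

The abstract odd-side chessboard estimate `Literature.Probability.LatticeModels.chessboard_le_rpow_odd` is a statement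
about ONE set of blocks `A ⊆ (ℤ/N)^d`.  For the plaquette observables of the Wilson theory the blocks of one
orientation `o` are the plaquettes of that orientation (dictionary `OddTorusChessboard.toPlaq`), and for a single
orientation the reflection Cauchy–Schwarz inequality of axis `i` reads `ψ A² ≤ ψ (csymP i A) · ψ (symM i 1 A)` for
transverse orientations and `ψ A² ≤ ψ (symM i 1 A) · ψ (csymP i A)` for in-plane ones — the same inequality.  For a
family `A = (A_o)_o` of patterns of SEVERAL orientations (a general finite set of plaquettes) the single Osterwalder–
Seiler Schwarz inequality of axis `i` symmetrises the transverse components in the closed positive half and the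
in-plane components in the closed negative half SIMULTANEOUSLY: it is the TWISTED inequality
`ψ A² ≤ ψ (twP i A) · ψ (twM i A)` with `twP i A = (o ↦ in-plane ? symM i 1 (A o) : csymP i (A o))` and `twM` the
other way round (written out inline below; `cls i o` records which components are twisted).  The exponent count
`size (twP i A) + size (twM i A) = 2 size A` holds componentwise whichever way round, so both twisted
symmetrisations of a maximiser of `Φ A = ψ A ^ (N^d) / ψ ⊤ ^ size A` are maximisers (`tPhi_tw_eq_of_isMax`).

References: J. Fröhlich, E. H. Lieb, Comm. Math. Phys. 60 (1978) 233–267, Thm. 2.2/2.3; J. Fröhlich, R. Israel,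
E. H. Lieb, B. Simon, Comm. Math. Phys. 62 (1978) 1–34, Thm. 2.2 (maximisation proof) and Thm. 4.1.  Finite
combinatorics and real arithmetic only; nothing here is a statement about the Yang–Mills mass gap.
-/

noncomputable section

open Finset
open Literature.Barriers.CriticalPhenomena.NonGibbs
open Literature.Probability.LatticeModels
open Literature.Probability.LatticeModels.OddChessboard

namespace Summit.QuantumFields.YangMills.Theorems.AllSidesChessboard

/-! ### §1. Cylinders of blocks -/

section Cyl

variable {d N : ℕ}

/-- Reflecting the `i`-th coordinate commutes with updating another coordinate. -/
theorem cellReflect_update {i j : Fin d} (h : j ≠ i) (k : ZMod N) (b : BlockIdx d N) (t : ZMod N) :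
    cellReflect i k (Function.update b j t) = Function.update (cellReflect i k b) j t := by
  ext m
  simp only [cellReflect_apply]
  by_cases hmj : m = j
  · subst hmj
    rw [Function.update_self, Function.update_of_ne h, Function.update_self]
  · rw [Function.update_of_ne hmj]
    by_cases hmi : m = i
    · subst hmi
      rw [Function.update_self, Function.update_self, Function.update_of_ne hmj]
    · rw [Function.update_of_ne hmi, Function.update_of_ne hmi, Function.update_of_ne hmj]

/-- Translating the `i`-th coordinate commutes with updating another coordinate. -/
theorem cellTranslate_update {i j : Fin d} (h : j ≠ i) (a : ZMod N) (b : BlockIdx d N) (t : ZMod N) :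
    cellTranslate i a (Function.update b j t) = Function.update (cellTranslate i a b) j t := by
  ext m
  simp only [cellTranslate_apply]
  by_cases hmj : m = j
  · subst hmj
    rw [Function.update_self, Function.update_of_ne h, Function.update_self]
  · rw [Function.update_of_ne hmj]
    by_cases hmi : m = i
    · subst hmi
      rw [Function.update_self, Function.update_self, Function.update_of_ne hmj]
    · rw [Function.update_of_ne hmi, Function.update_of_ne hmi, Function.update_of_ne hmj]

variable [NeZero N]

/-- A cylinder along `j` stays a cylinder along `j` under the closed positive symmetrisation of another axis. -/
theorem cyl_csymP {i j : Fin d} (h : j ≠ i) {B : Finset (BlockIdx d N)}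
    (hB : ∀ c ∈ B, ∀ t : ZMod N, Function.update c j t ∈ B) :
    ∀ c ∈ csymP i B, ∀ t : ZMod N, Function.update c j t ∈ csymP i B := by
  intro c hc t
  rw [csymP, mem_union, mem_inter, mem_image] at hc ⊢
  rcases hc with ⟨hcB, hcC⟩ | ⟨b, hb, rfl⟩
  · refine Or.inl ⟨hB c hcB t, ?_⟩
    rw [mem_chalfPlus] at hcC ⊢
    rwa [Function.update_of_ne (Ne.symm h)]
  · obtain ⟨hbB, hbC⟩ := mem_inter.1 hb
    refine Or.inr ⟨Function.update b j t, mem_inter.2 ⟨hB b hbB t, ?_⟩, cellReflect_update h 1 b t⟩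
    rw [mem_chalfPlus] at hbC ⊢
    rwa [Function.update_of_ne (Ne.symm h)]

/-- A cylinder along `j` stays a cylinder along `j` under the negative symmetrisation of another axis. -/
theorem cyl_symM {i j : Fin d} (h : j ≠ i) (k : ZMod N) {B : Finset (BlockIdx d N)}
    (hB : ∀ c ∈ B, ∀ t : ZMod N, Function.update c j t ∈ B) :
    ∀ c ∈ symM i k B, ∀ t : ZMod N, Function.update c j t ∈ symM i k B := by
  intro c hc t
  rw [symM, mem_union, mem_inter, mem_image] at hc ⊢
  rcases hc with ⟨hcB, hcC⟩ | ⟨b, hb, rfl⟩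
  · refine Or.inl ⟨hB c hcB t, ?_⟩
    rw [mem_halfMinus] at hcC ⊢
    rwa [Function.update_of_ne (Ne.symm h)]
  · obtain ⟨hbB, hbC⟩ := mem_inter.1 hb
    refine Or.inr ⟨Function.update b j t, mem_inter.2 ⟨hB b hbB t, ?_⟩, cellReflect_update h k b t⟩
    rw [mem_halfMinus] at hbC ⊢
    rwa [Function.update_of_ne (Ne.symm h)]

omit [NeZero N] in
/-- A cylinder along `j` stays a cylinder along `j` under the translations of another axis. -/
theorem cyl_translate {i j : Fin d} (h : j ≠ i) (a : ZMod N) {B : Finset (BlockIdx d N)}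
    (hB : ∀ c ∈ B, ∀ t : ZMod N, Function.update c j t ∈ B) :
    ∀ c ∈ B.image (cellTranslate i a), ∀ t : ZMod N, Function.update c j t ∈ B.image (cellTranslate i a) := by
  intro c hc t
  rw [mem_image] at hc ⊢
  obtain ⟨b, hb, rfl⟩ := hc
  exact ⟨Function.update b j t, hB b hb t, cellTranslate_update h a b t⟩

/-- A set of blocks which is a cylinder along every axis is empty or everything. -/
theorem eq_univ_of_forall_cyl {B : Finset (BlockIdx d N)}
    (hB : ∀ (j : Fin d), ∀ c ∈ B, ∀ t : ZMod N, Function.update c j t ∈ B) {c₀ : BlockIdx d N}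
    (hc₀ : c₀ ∈ B) : B = univ := by
  refine eq_univ_of_forall fun c => ?_
  suffices key : ∀ m : ℕ, (fun j : Fin d => if j.val < m then c j else c₀ j) ∈ B by
    have := key d
    convert this using 1
    funext j
    rw [if_pos j.isLt]
  intro m
  induction m with
  | zero =>
    have : (fun j : Fin d => if j.val < 0 then c j else c₀ j) = c₀ :=
      funext fun j => if_neg (Nat.not_lt_zero _)
    rw [this]; exact hc₀
  | succ m ih =>
    by_cases hm : m < d
    · have := hB ⟨m, hm⟩ _ ih (c ⟨m, hm⟩)
      convert this using 1
      funext j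
      by_cases hj : j = ⟨m, hm⟩
      · subst hj
        rw [Function.update_self, if_pos (Nat.lt_succ_self m)]
      · rw [Function.update_of_ne hj]
        have hne : j.val ≠ m := fun h' => hj (Fin.ext h')
        by_cases hlt : j.val < m
        · rw [if_pos hlt, if_pos (Nat.lt_succ_of_lt hlt)]
        · rw [if_neg hlt, if_neg (by omega)]
    · convert ih using 1
      funext j
      rw [if_pos (by omega), if_pos (by omega)]

end Cyl

/-! ### §2. Gluing slices: the missing public lemmas -/

section Glue

variable {d N : ℕ} [NeZero N]

/-- Membership in `glueSlices`. -/
theorem mem_glueSlices {i : Fin d} {σ : ZMod N → Finset (BlockIdx d N)} {c : BlockIdx d N} :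
    c ∈ glueSlices i σ ↔ ∃ c' ∈ σ (c i), Function.update c' i (c i) = c := by
  simp [glueSlices]

/-- Gluing the slices of `A` gives back `A`. -/
theorem glueSlices_slices (i : Fin d) (A : Finset (BlockIdx d N)) :
    glueSlices i (fun t => A.filter fun c => c i = t) = A := by
  ext c
  rw [mem_glueSlices]
  constructor
  · rintro ⟨c', hc', hc⟩
    rw [mem_filter] at hc'
    obtain ⟨hc'A, hci⟩ := hc'
    have : c' = c := by rw [← hc, ← hci, Function.update_eq_self]
    rwa [← this]
  · intro hc
    exact ⟨c, mem_filter.2 ⟨hc, rfl⟩, Function.update_eq_self _ _⟩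

/-- Gluing a rotated assignment is translating the glued set. -/
theorem glueSlices_rotate (i : Fin d) (σ : ZMod N → Finset (BlockIdx d N)) (a : ZMod N) :
    glueSlices i (fun t => σ (t + a)) = (glueSlices i σ).image (cellTranslate i (-a)) := by
  ext c
  rw [mem_glueSlices, mem_image]
  constructor
  · rintro ⟨c', hc', hc⟩
    refine ⟨cellTranslate i a c, ?_, ?_⟩
    · rw [mem_glueSlices]
      refine ⟨c', ?_, ?_⟩
      · simpa using hc'
      · rw [← hc]; simp
    · ext j; by_cases h : j = i
      · subst h; simp
      · simp [h]
  · rintro ⟨b, hb, rfl⟩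
    rw [mem_glueSlices] at hb
    obtain ⟨c', hc', hb'⟩ := hb
    refine ⟨c', ?_, ?_⟩
    · simpa using hc'
    · rw [← hb']
      ext j; by_cases h : j = i
      · subst h; simp
      · simp [h]

/-- The cylinder glued from a constant assignment is a cylinder along the gluing axis. -/
theorem cyl_glueSlices_const (i : Fin d) (X : Finset (BlockIdx d N)) :
    ∀ c ∈ glueSlices i (fun _ => X), ∀ t : ZMod N, Function.update c i t ∈ glueSlices i (fun _ => X) := by
  intro c hc t
  rw [mem_glueSlices] at hc ⊢
  obtain ⟨c', hc', hc⟩ := hc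
  refine ⟨c', hc', ?_⟩
  rw [← hc]
  simp

end Glue

/-! ### §3. Twisted symmetrisations of families and their exponent count -/

section Twist

variable {d S : ℕ} {O : Type*} [Fintype O] (cls : Fin d → O → Bool)

/-- **Exponent count for the twisted pair**: `size (twP i A) + size (twM i A) = 2 · size A` on the odd torus. -/
theorem size_twP_add_size_twM (hS : 1 ≤ S) (i : Fin d) (A : O → Finset (BlockIdx d (2 * S + 1))) :
    (∑ o, #(if cls i o then symM i 1 (A o) else csymP i (A o))) +
        (∑ o, #(if cls i o then csymP i (A o) else symM i 1 (A o))) = 2 * ∑ o, #(A o) := by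
  rw [← sum_add_distrib, mul_sum]
  refine sum_congr rfl fun o _ => ?_
  have h := card_csymP_add_card_symM_odd hS i (A o)
  cases cls i o
  · simpa using h
  · simp only [↓reduceIte]
    omega

end Twist

/-! ### §4. The functional `Φ` and its maximisers -/

section Phi

variable {d S : ℕ} {O : Type*} [Fintype O] (cls : Fin d → O → Bool)
  (ψ : (O → Finset (BlockIdx d (2 * S + 1))) → ℝ)

/-- The normalised functional `Φ A = ψ A ^ (N^d) / ψ ⊤ ^ (∑_o #(A o))` of the maximisation argument. -/
def tPhi (A : O → Finset (BlockIdx d (2 * S + 1))) : ℝ :=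
  ψ A ^ ((2 * S + 1) ^ d) / ψ (fun _ => univ) ^ (∑ o, #(A o))

/-- `Φ ≥ 0`. -/
theorem tPhi_nonneg (h0 : ∀ A, 0 ≤ ψ A) (A : O → Finset (BlockIdx d (2 * S + 1))) : 0 ≤ tPhi ψ A :=
  div_nonneg (pow_nonneg (h0 A) _) (pow_nonneg (h0 _) _)

/-- **The twisted Schwarz inequality passes to `Φ`.** -/
theorem tPhi_sq_le (hS : 1 ≤ S) (h1 : 0 < ψ fun _ => univ)
    (hcs : ∀ (i : Fin d) (A : O → Finset (BlockIdx d (2 * S + 1))),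
      ψ A ^ 2 ≤ ψ (fun o => if cls i o then symM i 1 (A o) else csymP i (A o)) *
        ψ (fun o => if cls i o then csymP i (A o) else symM i 1 (A o)))
    (i : Fin d) (A : O → Finset (BlockIdx d (2 * S + 1))) :
    tPhi ψ A ^ 2 ≤ tPhi ψ (fun o => if cls i o then symM i 1 (A o) else csymP i (A o)) *
      tPhi ψ (fun o => if cls i o then csymP i (A o) else symM i 1 (A o)) := by
  have hpow : (ψ A ^ (2 * S + 1) ^ d) ^ 2 ≤
      ψ (fun o => if cls i o then symM i 1 (A o) else csymP i (A o)) ^ (2 * S + 1) ^ d *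
        ψ (fun o => if cls i o then csymP i (A o) else symM i 1 (A o)) ^ (2 * S + 1) ^ d := by
    rw [← pow_mul, mul_comm, pow_mul, ← mul_pow]
    exact pow_le_pow_left₀ (sq_nonneg _) (hcs i A) _
  have hden : ψ (fun _ => univ) ^ (∑ o, #(if cls i o then symM i 1 (A o) else csymP i (A o))) *
      ψ (fun _ => univ) ^ (∑ o, #(if cls i o then csymP i (A o) else symM i 1 (A o))) =
      (ψ (fun _ => univ) ^ (∑ o, #(A o))) ^ 2 := by
    rw [← pow_add, size_twP_add_size_twM cls hS, pow_mul']
  simp only [tPhi, div_pow]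
  rw [div_mul_div_comm, hden]
  exact div_le_div_of_nonneg_right hpow (by positivity)

/-- **Both twisted symmetrisations of a maximiser of `Φ` are maximisers.** -/
theorem tPhi_tw_eq_of_isMax (hS : 1 ≤ S) (h0 : ∀ A, 0 ≤ ψ A) (h1 : 0 < ψ fun _ => univ)
    (hcs : ∀ (i : Fin d) (A : O → Finset (BlockIdx d (2 * S + 1))),
      ψ A ^ 2 ≤ ψ (fun o => if cls i o then symM i 1 (A o) else csymP i (A o)) *
        ψ (fun o => if cls i o then csymP i (A o) else symM i 1 (A o)))
    {M : ℝ} (hMpos : 0 < M) (hmax : ∀ A, tPhi ψ A ≤ M) {A : O → Finset (BlockIdx d (2 * S + 1))}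
    (hA : tPhi ψ A = M) (i : Fin d) :
    tPhi ψ (fun o => if cls i o then symM i 1 (A o) else csymP i (A o)) = M ∧
      tPhi ψ (fun o => if cls i o then csymP i (A o) else symM i 1 (A o)) = M := by
  have hP0 := tPhi_nonneg ψ h0 (fun o => if cls i o then symM i 1 (A o) else csymP i (A o))
  have hM0 := tPhi_nonneg ψ h0 (fun o => if cls i o then csymP i (A o) else symM i 1 (A o))
  have h := tPhi_sq_le cls ψ hS h1 hcs i A
  rw [hA] at h
  have hPle := hmax (fun o => if cls i o then symM i 1 (A o) else csymP i (A o))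
  have hMle := hmax (fun o => if cls i o then csymP i (A o) else symM i 1 (A o))
  constructor
  · refine le_antisymm hPle ?_
    by_contra hlt
    rw [not_le] at hlt
    nlinarith [mul_le_mul_of_nonneg_left hMle hP0, mul_lt_mul_of_pos_right hlt hMpos]
  · refine le_antisymm hMle ?_
    by_contra hlt
    rw [not_le] at hlt
    nlinarith [mul_le_mul_of_nonneg_right hPle hM0, mul_lt_mul_of_pos_left hlt hMpos]

/-- `Φ` is invariant under the diagonal translations when `ψ` is. -/
theorem tPhi_translate
    (htr : ∀ (i : Fin d) (a : ZMod (2 * S + 1)) (A : O → Finset (BlockIdx d (2 * S + 1))),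
      ψ (fun o => (A o).image (cellTranslate i a)) = ψ A)
    (i : Fin d) (a : ZMod (2 * S + 1)) (A : O → Finset (BlockIdx d (2 * S + 1))) :
    tPhi ψ (fun o => (A o).image (cellTranslate i a)) = tPhi ψ A := by
  unfold tPhi
  rw [htr]
  congr 2
  exact sum_congr rfl fun o _ => card_image_of_injective _ (cellTranslate i a).injective

end Phi

end Summit.QuantumFields.YangMills.Theorems.AllSidesChessboard

end
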